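import Literature.NumberTheory.Automorphic.Liu2021.SplitPlaceCentre
import Literature.NumberTheory.Automorphic.SchwartzPiLineIntertwiner
import Literature.NumberTheory.Automorphic.ParabolicIndGLFieldTransport
import Literature.NumberTheory.Automorphic.AdicCompletionDegreeOnePlaceEquiv
import Literature.NumberTheory.Automorphic.LinearAlgebraicGroups
import Literature.LinearAlgebra.Matrix.GeneralLinearGroupAbelianization
import Literature.NumberTheory.Automorphic.LocalLanglandsGLProofs
import Literature.NumberTheory.Automorphic.AdicCompletionLocalField
import HarnessLib

/-!
# [Liu2021, App. D, proof of Lem. D.1, first paragraph] — the split-place model of the `χ`-coinvariants of the Weil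
# representation: PROOF of the named fact `splitPlace_chiCoinv_iso_parabolicIndGL`, conditional on [Zelevinsky1980, Thm. 4.2]

Topic `NumberTheory/Automorphic/Liu2021`; namespace `Literature.NumberTheory.Automorphic.Liu2021`.  KERNEL ONLY: theorems; no
definition, no named fact, no `sorry`.

`splitPlace_chiCoinv_iso_parabolicIndGL_of_isIrreducible` — the named fact `splitPlace_chiCoinv_iso_parabolicIndGL`
(`Liu2021/SplitPlaceOscillatorModel.lean`: at a split place `w ∣ v`, for every smooth unitary section `s` of
`S̃p_{ψ_v}(𝕎_v) → Sp(𝕎_v)` over `ι_v` and every unitary continuous character `χ` of the centre `U(J₁)(F_v)`, the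
`χ`-coinvariants of `ω_s` are `GL_N(E_w)`-equivariantly isomorphic to `Ind_{Q_{N-1,1}}^{GL_N}((ν∘det) ⊠ χ′ν^{1-N})` for some
unitary continuous `ν, χ′`) HOLDS, CONDITIONALLY on the irreducibility of that induced representation — the named fact
`Zelevinsky1980.parabolicIndGL_detChar_unitary_isIrreducible` ([Zelevinsky1980, Thm. 4.2], used only for the surjectivity of
the intertwiner).  ASSEMBLY of the kernel pieces: the mixed model (`SplitPlaceMixedModel.exists_mixedModel`: `ω_s(κ_a) =
η(κ_a) Γ⁻¹ r(m(a⁻ᵀ)) Γ`, `η` unitary with open kernel), `η = ν ∘ det` (`GLAbelianization`), the centre `U(J₁)(F_v) ≅ F_vˣ`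
(`exists_centre_mulEquiv`), the type II computation over `F_v` (`SchwartzPiLine.exists_equiv_parabolicIndGL`, with
[MoeglinVignerasWaldspurger1987, Chap. 3 III.7 a)] and the modulus of `Q_{N-1,1}`), and the transport `F_v = E_w`
(`ParabolicIndGLFieldTransport`).  HC_CM is NOT proved by anything here.
-/

set_option autoImplicit false

noncomputable section

open NumberField IsDedekindDomain Matrix
open _root_.MeasureTheory
open scoped MatrixGroups
open Literature.RepresentationTheory (TwistedCoinv.rep TwistedCoinv.Coinv TwistedCoinv.mk TwistedCoinv.ker TwistedCoinv.mapEquiv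
  TwistedCoinv.mapEquiv_rep TwistedCoinv.mk_surjective TwistedCoinv.rep_mk TwistedCoinv.mapEquiv_mk)
open Literature.RepresentationTheory.HeisenbergGroup (MpPsi leviOpPi)
open Literature.RepresentationTheory.HeisenbergGroup.SymplecticMatrix (glEquiv)
open Literature.NumberTheory.GelbartRogawski1991.UnitaryDualPair.LocalSplitting (iota LocalMp localSchrodinger toPlace_splitCoord)
open Literature.NumberTheory.Automorphic.Zelevinsky1980 (lastBlockLabel maxParabolicLeviChar parabolicIndGL_detChar_unitary_isIrreducible)
open Literature.NumberTheory.Automorphic.UnitaryGroup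

namespace Literature.NumberTheory.Automorphic.Liu2021

/-! ## §1 A continuous section of `det` and characters of `GL_N` -/

section DetSection

variable {K : Type} [Field K] [TopologicalSpace K] {N : ℕ}

/-- the corner torus `t ↦ diag(1, …, t, …, 1)` (at index `i₀`) is continuous `Kˣ → GL_N(K)` and `det ∘ d = id`.
[cite: Zelevinsky1980, §1.1, p. 170] -/
theorem exists_continuous_det_section (i₀ : Fin N) :
    ∃ d : Kˣ →* GL (Fin N) K, Continuous d ∧ ∀ t, Matrix.GeneralLinearGroup.det (d t) = t := by
  classical
  let d : Kˣ →* GL (Fin N) K := (diagonalGL (Fin N) K).comp (MonoidHom.mulSingle (fun _ : Fin N => Kˣ) i₀)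
  have hd : ∀ t, ((d t : GL (Fin N) K) : Matrix (Fin N) (Fin N) K) =
      Matrix.diagonal fun i => ((Pi.mulSingle i₀ t : Fin N → Kˣ) i : K) := fun t => coe_diagonalGL _
  refine ⟨d, ?_, fun t => ?_⟩
  · refine Units.continuous_iff.2 ⟨?_, ?_⟩
    · change Continuous fun t : Kˣ => ((d t : GL (Fin N) K) : Matrix (Fin N) (Fin N) K)
      have : (fun t : Kˣ => ((d t : GL (Fin N) K) : Matrix (Fin N) (Fin N) K)) =
          fun t => Matrix.diagonal fun i => ((Pi.mulSingle i₀ t : Fin N → Kˣ) i : K) := funext hd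
      rw [this]
      refine (continuous_pi fun i => ?_).matrix_diagonal
      by_cases hi : i = i₀
      · subst hi; simp only [Pi.mulSingle_eq_same]; exact Units.continuous_val
      · simp only [Pi.mulSingle_eq_of_ne hi, Units.val_one]; exact continuous_const
    · change Continuous fun t : Kˣ => (((d t)⁻¹ : GL (Fin N) K) : Matrix (Fin N) (Fin N) K)
      have : (fun t : Kˣ => (((d t)⁻¹ : GL (Fin N) K) : Matrix (Fin N) (Fin N) K)) =
          fun t => Matrix.diagonal fun i => ((Pi.mulSingle i₀ t⁻¹ : Fin N → Kˣ) i : K) := by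
        funext t; rw [← map_inv, hd, Pi.mulSingle_inv]
      rw [this]
      refine (continuous_pi fun i => ?_).matrix_diagonal
      by_cases hi : i = i₀
      · subst hi; simp only [Pi.mulSingle_eq_same]; exact Units.continuous_coe_inv
      · simp only [Pi.mulSingle_eq_of_ne hi, Units.val_one]; exact continuous_const
  · apply Units.ext
    rw [Matrix.GeneralLinearGroup.val_det_apply, hd, Matrix.det_diagonal]
    have : (fun i => ((Pi.mulSingle i₀ t : Fin N → Kˣ) i : K)) = Pi.mulSingle i₀ (t : K) := by
      funext i
      by_cases hi : i = i₀
      · subst hi; simp only [Pi.mulSingle_eq_same]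
      · simp only [Pi.mulSingle_eq_of_ne hi, Units.val_one]
    rw [this, Finset.prod_pi_mulSingle', if_pos (Finset.mem_univ _)]

end DetSection

/-- a homomorphism of a topological group with open kernel is continuous (it is constant on the cosets of the kernel).
[cite: BushnellHenniart2006, §1.1, p. 11] -/
theorem continuous_of_isOpen_ker {G M : Type*} [Group G] [TopologicalSpace G] [IsTopologicalGroup G] [Monoid M]
    [TopologicalSpace M] (f : G →* M) (hf : IsOpen (f.ker : Set G)) : Continuous f := by
  refine continuous_def.2 fun U _ => isOpen_iff_mem_nhds.2 fun x hx => ?_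
  have hsub : (fun y => x * y) '' (f.ker : Set G) ⊆ f ⁻¹' U := by
    rintro _ ⟨k, hk, rfl⟩
    rw [Set.mem_preimage, map_mul, (MonoidHom.mem_ker).1 hk, mul_one]
    exact hx
  exact Filter.mem_of_superset (((Homeomorph.mulLeft x).isOpenMap _ hf).mem_nhds ⟨1, f.ker.one_mem, mul_one x⟩) hsub

section Transport

variable {K K' : Type*} [Field K] [ValuativeRel K] [TopologicalSpace K] [IsNonarchimedeanLocalField K]
  [Field K'] [ValuativeRel K'] [TopologicalSpace K'] [IsNonarchimedeanLocalField K'] {N : ℕ}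

/-- `ParabolicIndGLFieldTransport.exists_equiv_parabolicIndGL_map` with the `K`-side characters `ν₁ = ν ∘ f`,
`χ₁ = (χ′ν^{1-N}) ∘ f` as variables (so that no rewriting inside the induced spaces is needed downstream).
[cite: BernsteinZelevinsky1976, §2.21–2.25] -/
theorem exists_equiv_parabolicIndGL_map_of_eq (f : K ≃+* K') (hf : Continuous f) (hf' : Continuous f.symm)
    (ν χ' : K'ˣ →* ℂˣ) (ν₁ χ₁ : Kˣ →* ℂˣ) (h₁ : ν.comp (Units.map (f : K →+* K').toMonoidHom) = ν₁)
    (h₂ : (χ' * ν ^ (1 - (N : ℤ))).comp (Units.map (f : K →+* K').toMonoidHom) = χ₁) :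
    ∃ (Φ : GL (Fin N) K ≃* GL (Fin N) K') (Ψ :
      Representation.SmoothInd (standardParabolicGL K (lastBlockLabel N))
        (Representation.twist (((Representation.trivial ℂ (Π a : Bool, GL {i : Fin N // lastBlockLabel N i = a} K) ℂ).twist
          (maxParabolicLeviChar K N ν₁ χ₁)).comp (leviProjection K (lastBlockLabel N)))
          (rootDeltaChar (standardParabolicGL K (lastBlockLabel N)))) ≃ₗ[ℂ]
      Representation.SmoothInd (standardParabolicGL K' (lastBlockLabel N))
        (Representation.twist (((Representation.trivial ℂ (Π a : Bool, GL {i : Fin N // lastBlockLabel N i = a} K') ℂ).twist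
          (maxParabolicLeviChar K' N ν (χ' * ν ^ (1 - (N : ℤ))))).comp (leviProjection K' (lastBlockLabel N)))
          (rootDeltaChar (standardParabolicGL K' (lastBlockLabel N))))),
      (∀ g, Φ g = Matrix.GeneralLinearGroup.map (f : K →+* K') g) ∧
      ∀ g φ, Ψ (Representation.parabolicIndGL K (lastBlockLabel N)
          ((Representation.trivial ℂ (Π a : Bool, GL {i : Fin N // lastBlockLabel N i = a} K) ℂ).twist
            (maxParabolicLeviChar K N ν₁ χ₁)) g φ) =
        Representation.parabolicIndGL K' (lastBlockLabel N)
          ((Representation.trivial ℂ (Π a : Bool, GL {i : Fin N // lastBlockLabel N i = a} K') ℂ).twist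
            (maxParabolicLeviChar K' N ν (χ' * ν ^ (1 - (N : ℤ))))) (Φ g) (Ψ φ) := by
  subst h₁ h₂
  exact ParabolicIndGLFieldTransport.exists_equiv_parabolicIndGL_map f hf hf' ν (χ' * ν ^ (1 - (N : ℤ)))

end Transport

/-! ## §2 The named fact, conditionally on [Zelevinsky1980, Thm. 4.2] -/

set_option maxHeartbeats 2000000 in -- a long assembly: ~40 intermediate facts over heavy types (`SchwartzBruhat`, `U(J)(F_v)`)
/-- **[Liu2021, App. D, proof of Lemma D.1, first paragraph, p. 126] — the split-place model HOLDS** (conditionally on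
the irreducibility input [Zelevinsky1980, Thm. 4.2] = the named fact `parabolicIndGL_detChar_unitary_isIrreducible`):
`parabolicIndGL_detChar_unitary_isIrreducible → splitPlace_chiCoinv_iso_parabolicIndGL`.  Proof = the assembly described
in the module docstring; the characters are `ν = ν_K ∘ ι_w⁻¹` with `η ∘ φ = ν_K ∘ det` (`η` the character of the mixed
model, `φ : GL_N(F_v) ≅ U(J)(F_v)`) and `χ′ = χ ∘ T⁻¹ ∘ ι_w⁻¹` (`T : U(J₁)(F_v) ≅ F_vˣ`).
[cite: Liu2021, App. D, proof of Lemma D.1 (first paragraph), p. 126; MoeglinVignerasWaldspurger1987, Chap. 3 III.7 a)] -/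
theorem splitPlace_chiCoinv_iso_parabolicIndGL_of_isIrreducible
    (hIV3b : parabolicIndGL_detChar_unitary_isIrreducible.{0}) : splitPlace_chiCoinv_iso_parabolicIndGL := by
  intro F _ _ E _ _ _ _ c hc1 N hN δ hcδ hδ d hd T hT hTd J hJ hJh v w hw hJw _ _ μX _ s hs hsm hsu J₁ hJ₁ χ hχu hχc _
  classical
  -- notation
  haveI : BorelSpace (v.adicCompletion F)ˣ := Units.borelSpace
  haveI hNE : Nonempty (Fin N) := ⟨⟨0, by omega⟩⟩
  have hN1 : 1 ≤ N := by omega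
  -- §A the mixed model
  let μ' : Measure (v.adicCompletion F) := Measure.addHaar
  have hμinst : μ'.IsAddHaarMeasure := inferInstance
  have hmm := @SplitPlaceMixedModel.exists_mixedModel F _ _ E _ _ _ _ c N δ hcδ hδ d hd T hT hTd J hJ v hc1 hJh w hw hJw _ _
    μ' hμinst s
  have hmm' := hmm hs
  obtain ⟨Γ, η, hΓi, hmodel⟩ := hmm'
  clear hmm
  have hηu := SplitPlaceMixedModel.norm_eq_one_of_mixedModel F E c N T v hc1 hJh w hw hJw μ' s Γ η hΓi hmodel μX hsu
  have hηo := SplitPlaceMixedModel.isOpen_ker_of_mixedModel F E c N J v hc1 hJh w hw hJw s hsm Γ η hmodel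
  have hφex := SplitPlaceMixedModel.exists_continuousMulEquiv_symm_map F E c N J v hc1 hJh w hw hJw
  obtain ⟨φ, hφ⟩ := hφex
  -- §B `η ∘ φ = ν_K ∘ det`, `ν_K` unitary with open kernel
  have hνKex := Literature.LinearAlgebra.Matrix.GLAbelianization.existsUnique_eq_comp_det_of_infinite
    (η.comp φ.toMulEquiv.toMonoidHom)
  obtain ⟨νK, hνK, -⟩ := hνKex
  have hdsecex := exists_continuous_det_section (K := v.adicCompletion F) (⟨0, by omega⟩ : Fin N)
  obtain ⟨dsec, hdsec_cont, hdsec_det⟩ := hdsecex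
  have hνK_apply : ∀ a : GL (Fin N) (v.adicCompletion F), η (φ a) = νK (Matrix.GeneralLinearGroup.det a) := fun a => by
    have := DFunLike.congr_fun hνK a
    exact this
  have hνKd : ∀ t, νK t = η (φ (dsec t)) := fun t => by rw [hνK_apply, hdsec_det]
  have hνKu : ∀ t, ‖((νK t : ℂˣ) : ℂ)‖ = 1 := fun t => by rw [hνKd, hφ]; exact hηu _
  have hνKo : IsOpen (νK.ker : Set (v.adicCompletion F)ˣ) := by
    have : (νK.ker : Set (v.adicCompletion F)ˣ) = (fun t => φ (dsec t)) ⁻¹' (η.ker : Set (localPi E c N J v)) := by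
      ext t
      simp only [SetLike.mem_coe, MonoidHom.mem_ker, Set.mem_preimage, hνKd]
    rw [this]
    exact hηo.preimage (φ.continuous.comp hdsec_cont)
  -- §C the conjugated representation `π_K = Γ ω_s(φ ·) Γ⁻¹` of `GL_N(F_v)`
  have hπKex : ∃ πK : Representation ℂ (GL (Fin N) (v.adicCompletion F)) (SchwartzBruhat (Fin N → v.adicCompletion F)),
      ∀ a Ψ, πK a Ψ = Γ ((MpPsi.toRep (localSchrodinger F N T v)).comp s (φ a) (Γ.symm Ψ)) := by
    refine ⟨{ toFun := fun a => Γ.toLinearMap ∘ₗ (MpPsi.toRep (localSchrodinger F N T v)).comp s (φ a) ∘ₗ Γ.symm.toLinearMap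
              map_one' := ?_
              map_mul' := fun a b => ?_ }, fun a Ψ => rfl⟩
    · apply LinearMap.ext; intro Ψ
      simp only [map_one, LinearMap.coe_comp, LinearEquiv.coe_coe, Function.comp_apply, Module.End.one_apply,
        LinearEquiv.apply_symm_apply]
    · apply LinearMap.ext; intro Ψ
      simp only [map_mul, LinearMap.coe_comp, LinearEquiv.coe_coe, Function.comp_apply, Module.End.mul_apply,
        LinearEquiv.symm_apply_apply]
  obtain ⟨πK, hπK⟩ := hπKex
  have hπK_model : ∀ (a : GL (Fin N) (v.adicCompletion F)) (Ψ : SchwartzBruhat (Fin N → v.adicCompletion F)),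
      πK a Ψ = ((νK (Matrix.GeneralLinearGroup.det a) : ℂˣ) : ℂ) • leviOpPi (glEquiv (GLn.contragredient a)) Ψ := by
    intro a Ψ
    rw [hπK, ← hνK_apply, hφ, hmodel, map_smul, LinearEquiv.apply_symm_apply, LinearEquiv.apply_symm_apply]
  have hπKs : πK.IsSmooth := by
    intro Ψ
    refine Subgroup.isOpen_mono (H₁ := (Representation.stabilizerSubgroup ((MpPsi.toRep (localSchrodinger F N T v)).comp s)
      (Γ.symm Ψ)).comap φ.toMulEquiv.toMonoidHom) ?_ ((hsm (Γ.symm Ψ)).preimage φ.continuous)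
    intro a ha
    rw [Subgroup.mem_comap, Representation.mem_stabilizerSubgroup] at ha
    rw [Representation.mem_stabilizerSubgroup, hπK]
    have ha' : (MpPsi.toRep (localSchrodinger F N T v)).comp s (φ a) (Γ.symm Ψ) = Γ.symm Ψ := ha
    rw [ha', LinearEquiv.apply_symm_apply]
  have hcomm : ∀ (g : GL (Fin N) (v.adicCompletion F)) (t : (v.adicCompletion F)ˣ),
      Commute (πK g) ((πK.comp (Units.map (Matrix.scalar (Fin N)).toMonoidHom)) t) := by
    intro g t
    change πK g * πK (Units.map (Matrix.scalar (Fin N)).toMonoidHom t) = πK (Units.map (Matrix.scalar (Fin N)).toMonoidHom t) * πK g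
    rw [← map_mul, ← map_mul, SchwartzPiLine.scalar_mul_comm]
  have hνKc : Continuous fun t => ((νK t : ℂˣ) : ℂ) :=
    Units.continuous_val.comp (continuous_of_isOpen_ker νK hνKo)
  -- §D the centre `T_c : U(J₁)(F_v) ≃* F_vˣ`, the character `χ_K = χ ∘ T_c⁻¹`, and `localCenter z = φ (T_c z • 1)`
  have hTcex := SplitPlaceMixedModel.exists_centre_mulEquiv F E c v hcδ hδ hd hc1 w hw hJ₁
  obtain ⟨Tc, hTc, hTc_cont⟩ := hTcex
  have hχKex : ∃ χK : (v.adicCompletion F)ˣ →* ℂˣ, χK = χ.comp Tc.symm.toMonoidHom := ⟨_, rfl⟩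
  obtain ⟨χK, hχK⟩ := hχKex
  have hχK_apply : ∀ z, χK (Tc z) = χ z := fun z => by
    rw [hχK, MonoidHom.comp_apply, MulEquiv.coe_toMonoidHom, MulEquiv.symm_apply_apply]
  have hχKu : ∀ t, ‖((χK t : ℂˣ) : ℂ)‖ = 1 := fun t => by rw [hχK]; exact hχu _
  have hχKc : Continuous fun t => ((χK t : ℂˣ) : ℂ) := by rw [hχK]; exact hχc.comp hTc_cont
  have hχKo : IsOpen (χK.ker : Set (v.adicCompletion F)ˣ) := by
    have hinv : (fun t => (((χK t)⁻¹ : ℂˣ) : ℂ)) = (fun t => ((χK t : ℂˣ) : ℂ)) ∘ fun t => t⁻¹ :=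
      funext fun t => by simp only [Function.comp_apply, map_inv]
    have hcont : Continuous χK := Units.continuous_iff.2 ⟨hχKc, by rw [hinv]; exact hχKc.comp continuous_inv⟩
    exact isOpen_ker_quasiChar_holds ⟨χK, hcont⟩
  have hkey : ∀ z : localPi E c 1 J₁ v,
      localCenter E c N J J₁ hJ₁ v z = φ (Units.map (Matrix.scalar (Fin N)).toMonoidHom (Tc z)) := by
    intro z
    rw [hφ]
    refine SplitPlaceMixedModel.localCenter_eq_symm_map F E c N hcδ hδ hd v hc1 hJh w hw hJw hJ₁ z _ ?_
    rw [SchwartzPiLine.coe_scalar]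
    congr 1
    apply (toPlace v w).injective
    rw [hTc z, toPlace_splitCoord F E c hcδ hδ hd v w hw]
  -- §E the coinvariants: `Coinv(ω_s ∘ localCenter, χ) ≅ Coinv(π_K ∘ scalar ∘ T_c, χ) = Coinv(π_K ∘ scalar, χ_K)` along `Γ`
  have hc₁ : ∀ (a : GL (Fin N) (v.adicCompletion F)) (z : localPi E c 1 J₁ v), Commute (πK a)
      (((πK.comp (Units.map (Matrix.scalar (Fin N)).toMonoidHom)).comp Tc.toMonoidHom) z) := fun a z => hcomm a (Tc z)
  have hT₁ : ∀ (z : localPi E c 1 J₁ v) (Ψ : SchwartzBruhat (Fin N → v.adicCompletion F)),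
      ((πK.comp (Units.map (Matrix.scalar (Fin N)).toMonoidHom)).comp Tc.toMonoidHom) z (Γ Ψ) =
        (((fun _ => (1 : ℂˣ)) z : ℂˣ) : ℂ) •
          Γ ((((MpPsi.toRep (localSchrodinger F N T v)).comp s).comp (localCenter E c N J J₁ hJ₁ v)) z Ψ) := by
    intro z Ψ
    change πK (Units.map (Matrix.scalar (Fin N)).toMonoidHom (Tc z)) (Γ Ψ) =
      ((1 : ℂˣ) : ℂ) • Γ ((MpPsi.toRep (localSchrodinger F N T v)).comp s (localCenter E c N J J₁ hJ₁ v z) Ψ)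
    rw [Units.val_one, one_smul, hπK, LinearEquiv.symm_apply_apply, hkey]
  have hχ₁ : ∀ z : localPi E c 1 J₁ v, χ z = (fun _ => (1 : ℂˣ)) z * χ z := fun z => (one_mul _).symm
  have hker : TwistedCoinv.ker ((πK.comp (Units.map (Matrix.scalar (Fin N)).toMonoidHom)).comp Tc.toMonoidHom) χ =
      TwistedCoinv.ker (πK.comp (Units.map (Matrix.scalar (Fin N)).toMonoidHom)) χK := by
    unfold TwistedCoinv.ker
    congr 1
    ext u
    simp only [Set.mem_range, Prod.exists]
    constructor
    · rintro ⟨z, Ψ, rfl⟩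
      exact ⟨Tc z, Ψ, by rw [hχK_apply]; rfl⟩
    · rintro ⟨t, Ψ, rfl⟩
      refine ⟨Tc.symm t, Ψ, ?_⟩
      change πK (Units.map (Matrix.scalar (Fin N)).toMonoidHom (Tc (Tc.symm t))) Ψ - ((χ (Tc.symm t) : ℂˣ) : ℂ) • Ψ =
        πK (Units.map (Matrix.scalar (Fin N)).toMonoidHom t) Ψ - ((χK t : ℂˣ) : ℂ) • Ψ
      rw [← hχK_apply (Tc.symm t), MulEquiv.apply_symm_apply]
  -- §F irreducibility [Zelevinsky1980, Thm. 4.2] and the `F_v`-model [MVW, III.7 a)]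
  haveI : BorelSpace (v.adicCompletion F)ˣ := Units.borelSpace
  have hχ''u : ∀ t, ‖(((χK * νK ^ (1 - (N : ℤ))) t : ℂˣ) : ℂ)‖ = 1 := fun t => by
    rw [MonoidHom.mul_apply, MonoidHom.zpow_apply, Units.val_mul, Units.val_zpow_eq_zpow_val, norm_mul, norm_zpow,
      hχKu, hνKu, _root_.one_zpow, mul_one]
  have hχ''c : Continuous fun t => (((χK * νK ^ (1 - (N : ℤ))) t : ℂˣ) : ℂ) := by
    have : (fun t => (((χK * νK ^ (1 - (N : ℤ))) t : ℂˣ) : ℂ)) =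
        fun t => ((χK t : ℂˣ) : ℂ) * (((νK t : ℂˣ) : ℂ) ^ (1 - (N : ℤ))) := by
      funext t
      rw [MonoidHom.mul_apply, MonoidHom.zpow_apply, Units.val_mul, Units.val_zpow_eq_zpow_val]
    rw [this]
    refine hχKc.mul (hνKc.zpow₀ _ fun t => Or.inl ?_)
    exact Units.ne_zero _
  have hirr := hIV3b (v.adicCompletion F) N νK (χK * νK ^ (1 - (N : ℤ))) hνKu hνKc hχ''u hχ''c
  have hΘBex := SchwartzPiLine.exists_equiv_parabolicIndGL πK νK χK hπK_model
    (Measure.haar : Measure (v.adicCompletion F)ˣ) hN1 hνKo hνKu hχKo hχKu hπKs hcomm hirr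
  obtain ⟨ΘB, hΘB⟩ := hΘBex
  -- §G transport `F_v = E_w` along `ι_w`
  have hef := ramificationIdx_eq_one_and_inertiaDeg_eq_one_of_smul_ne F c hw
  obtain ⟨he1, hf1⟩ := hef
  haveI := UnitaryGroup.PlacesOver.liesOver w
  have hιex : ∃ ι : v.adicCompletion F ≃+* w.1.adicCompletion E, (∀ x, ι x = toPlace v w x) ∧ Continuous ι ∧
      Continuous ι.symm :=
    ⟨adicCompletionEquivOfDegreeOne F E v w.1 he1 hf1, fun _ => rfl,
      continuous_adicCompletionEquivOfDegreeOne F E v w.1 he1 hf1,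
      continuous_adicCompletionEquivOfDegreeOne_symm F E v w.1 he1 hf1⟩
  obtain ⟨ιw, hιw, hιc, hιc'⟩ := hιex
  have hνex : ∃ ν : (w.1.adicCompletion E)ˣ →* ℂˣ,
      ν = νK.comp (Units.map (ιw.symm : w.1.adicCompletion E →+* v.adicCompletion F).toMonoidHom) := ⟨_, rfl⟩
  obtain ⟨ν, hν⟩ := hνex
  have hχ'ex : ∃ χ' : (w.1.adicCompletion E)ˣ →* ℂˣ,
      χ' = χK.comp (Units.map (ιw.symm : w.1.adicCompletion E →+* v.adicCompletion F).toMonoidHom) := ⟨_, rfl⟩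
  obtain ⟨χ', hχ'⟩ := hχ'ex
  have hmap_symm : ∀ t : (v.adicCompletion F)ˣ,
      Units.map (ιw.symm : w.1.adicCompletion E →+* v.adicCompletion F).toMonoidHom
        (Units.map (ιw : v.adicCompletion F →+* w.1.adicCompletion E).toMonoidHom t) = t := fun t =>
    Units.ext (ιw.symm_apply_apply (t : v.adicCompletion F))
  have hν_apply : ∀ t, ν (Units.map (ιw : v.adicCompletion F →+* w.1.adicCompletion E).toMonoidHom t) = νK t :=
    fun t => by rw [hν, MonoidHom.comp_apply, hmap_symm]
  have hχ'_apply : ∀ t, χ' (Units.map (ιw : v.adicCompletion F →+* w.1.adicCompletion E).toMonoidHom t) = χK t :=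
    fun t => by rw [hχ', MonoidHom.comp_apply, hmap_symm]
  have e1 : ν.comp (Units.map (ιw : v.adicCompletion F →+* w.1.adicCompletion E).toMonoidHom) = νK :=
    MonoidHom.ext fun t => by rw [MonoidHom.comp_apply, hν_apply]
  have e2 : (χ' * ν ^ (1 - (N : ℤ))).comp (Units.map (ιw : v.adicCompletion F →+* w.1.adicCompletion E).toMonoidHom) =
      χK * νK ^ (1 - (N : ℤ)) :=
    MonoidHom.ext fun t => by
      rw [MonoidHom.comp_apply, MonoidHom.mul_apply, MonoidHom.mul_apply, MonoidHom.zpow_apply, MonoidHom.zpow_apply,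
        hν_apply, hχ'_apply]
  have hT := exists_equiv_parabolicIndGL_map_of_eq ιw hιc hιc' ν χ' νK (χK * νK ^ (1 - (N : ℤ))) e1 e2
  obtain ⟨Φ, Ψ, hΦ, hΨ⟩ := hT
  -- unitarity and continuity of `ν`, `χ′`
  have hνu : ∀ x, ‖((ν x : ℂˣ) : ℂ)‖ = 1 := fun x => by rw [hν]; exact hνKu _
  have hνc : Continuous fun x => ((ν x : ℂˣ) : ℂ) := by
    rw [hν]; exact hνKc.comp (Continuous.units_map _ hιc')
  have hχ'u : ∀ x, ‖((χ' x : ℂˣ) : ℂ)‖ = 1 := fun x => by rw [hχ']; exact hχKu _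
  have hχ'c : Continuous fun x => ((χ' x : ℂˣ) : ℂ) := by
    rw [hχ']; exact hχKc.comp (Continuous.units_map _ hιc')
  refine ⟨ν, χ', hνu, hνc, hχ'u, hχ'c, ?_⟩
  -- §H the composite isomorphism and its equivariance
  have h2 : ∀ Ψ₁ : SchwartzBruhat (Fin N → v.adicCompletion F),
      Submodule.quotEquivOfEq _ _ hker (TwistedCoinv.mk
        ((πK.comp (Units.map (Matrix.scalar (Fin N)).toMonoidHom)).comp Tc.toMonoidHom) χ Ψ₁) =
        TwistedCoinv.mk (πK.comp (Units.map (Matrix.scalar (Fin N)).toMonoidHom)) χK Ψ₁ := fun Ψ₁ => rfl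
  have hΘB' : ∀ (a : GL (Fin N) (v.adicCompletion F)) (Ψ₁ : SchwartzBruhat (Fin N → v.adicCompletion F)),
      ΘB (TwistedCoinv.mk (πK.comp (Units.map (Matrix.scalar (Fin N)).toMonoidHom)) χK (πK a Ψ₁)) =
        Representation.parabolicIndGL (v.adicCompletion F) (lastBlockLabel N)
          ((Representation.trivial ℂ (Π b : Bool, GL {i : Fin N // lastBlockLabel N i = b} (v.adicCompletion F)) ℂ).twist
            (maxParabolicLeviChar (v.adicCompletion F) N νK (χK * νK ^ (1 - (N : ℤ))))) a
          (ΘB (TwistedCoinv.mk (πK.comp (Units.map (Matrix.scalar (Fin N)).toMonoidHom)) χK Ψ₁)) := by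
    intro a Ψ₁
    rw [← hΘB a, TwistedCoinv.rep_mk]
  have HC : ∀ (g : localPi E c N J v) (z : localPi E c 1 J₁ v),
      Commute (((MpPsi.toRep (localSchrodinger F N T v)).comp s) g)
        ((((MpPsi.toRep (localSchrodinger F N T v)).comp s).comp (localCenter E c N J J₁ hJ₁ v)) z) :=
    fun g z => (show Commute g (localCenter E c N J J₁ hJ₁ v z) from localCenter_comm E c N J J₁ hJ₁ v z g).map
      ((MpPsi.toRep (localSchrodinger F N T v)).comp s)
  have hΘcex : ∃ Θc : TwistedCoinv.Coinv (((MpPsi.toRep (localSchrodinger F N T v)).comp s).comp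
      (localCenter E c N J J₁ hJ₁ v)) χ ≃ₗ[ℂ] _, ∀ y, Θc y = ((((TwistedCoinv.mapEquiv _ χ _ χ Γ (fun _ => (1 : ℂˣ)) hT₁ hχ₁).trans
      (Submodule.quotEquivOfEq _ _ hker)).trans ΘB).trans Ψ) y := ⟨_, fun _ => rfl⟩
  obtain ⟨Θc, hΘc⟩ := hΘcex
  have hΘc_mk : ∀ Ψ₁ : SchwartzBruhat (Fin N → v.adicCompletion F),
      Θc (TwistedCoinv.mk _ χ Ψ₁) = Ψ (ΘB (TwistedCoinv.mk (πK.comp (Units.map (Matrix.scalar (Fin N)).toMonoidHom)) χK (Γ Ψ₁))) := by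
    intro Ψ₁
    rw [hΘc, LinearEquiv.trans_apply, LinearEquiv.trans_apply, LinearEquiv.trans_apply, TwistedCoinv.mapEquiv_mk, h2]
  refine ⟨Θc, fun g x => ?_⟩
  have hgex := Φ.surjective g
  obtain ⟨a, rfl⟩ := hgex
  have hga : Matrix.GeneralLinearGroup.map (toPlace v w) a = Φ a := by
    rw [hΦ]
    exact Units.ext (Matrix.ext fun i j => (hιw _).symm)
  have heΦ : (localPiSplitEquiv c J hc1 hJh w hw hJw).symm.toMonoidHom (Φ a) = φ a :=
    ((congrArg ((localPiSplitEquiv c J hc1 hJh w hw hJw).symm : _ → localPi E c N J v) hga).symm.trans (hφ a).symm)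
  have hxex := TwistedCoinv.mk_surjective _ χ x
  obtain ⟨Ψ₀, rfl⟩ := hxex
  have h3 : Γ ((MpPsi.toRep (localSchrodinger F N T v)).comp s (φ a) Ψ₀) = πK a (Γ Ψ₀) := by
    rw [hπK, LinearEquiv.symm_apply_apply]
  have lhs_eq : ((TwistedCoinv.rep χ ((MpPsi.toRep (localSchrodinger F N T v)).comp s) HC).comp
      (localPiSplitEquiv c J hc1 hJh w hw hJw).symm.toMonoidHom) (Φ a)
      (TwistedCoinv.mk (((MpPsi.toRep (localSchrodinger F N T v)).comp s).comp (localCenter E c N J J₁ hJ₁ v)) χ Ψ₀) =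
      TwistedCoinv.mk (((MpPsi.toRep (localSchrodinger F N T v)).comp s).comp (localCenter E c N J J₁ hJ₁ v)) χ
        (((MpPsi.toRep (localSchrodinger F N T v)).comp s) (φ a) Ψ₀) :=
    ((LinearMap.congr_fun (MonoidHom.comp_apply
        (TwistedCoinv.rep χ ((MpPsi.toRep (localSchrodinger F N T v)).comp s) HC)
        (localPiSplitEquiv c J hc1 hJh w hw hJw).symm.toMonoidHom (Φ a)) _).trans
      (TwistedCoinv.rep_mk χ _ HC _ Ψ₀)).trans
      (congrArg (fun y => TwistedCoinv.mk (((MpPsi.toRep (localSchrodinger F N T v)).comp s).comp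
        (localCenter E c N J J₁ hJ₁ v)) χ (((MpPsi.toRep (localSchrodinger F N T v)).comp s) y Ψ₀)) heΦ)
  exact (congrArg Θc lhs_eq).trans (((hΘc_mk _).trans ((congrArg (fun y => Ψ (ΘB
    (TwistedCoinv.mk (πK.comp (Units.map (Matrix.scalar (Fin N)).toMonoidHom)) χK y))) h3).trans
    ((congrArg Ψ (hΘB' a (Γ Ψ₀))).trans (hΨ a _)))).trans
    (congrArg (Representation.parabolicIndGL (w.1.adicCompletion E) (lastBlockLabel N)
      ((Representation.trivial ℂ (Π b : Bool, GL {i : Fin N // lastBlockLabel N i = b} (w.1.adicCompletion E)) ℂ).twist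
        (maxParabolicLeviChar (w.1.adicCompletion E) N ν (χ' * ν ^ (1 - (N : ℤ))))) (Φ a)) (hΘc_mk Ψ₀).symm))

end Literature.NumberTheory.Automorphic.Liu2021

end
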